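import Mathlib.NumberTheory.Padics.PadicVal.Basic
import Literature.NumberTheory.DiophantineGeometry.PastenSubexpPlaces

/-!
# The decisive-prime bootstrap, II: the shape of non-face triples on four primes

Helpers (`--supports`) for the stub `stub_decisivePrimeBootstrap` of the line
`matveev-face-clearing` for the crux
`Summit.ABC.ABC.Theses.RibetTakahashiSplit.FewPrimeValuationProduct` (stmt-ABC-1563). An abc
triple `a + b = c` supported on `≤ 4` primes, no member of which is a power of two, has the rigid
shape `{a, b, c} = {2^i ℓ^e, 2^j P^X, 2^m Q^Z}` with `ℓ, P, Q` distinct odd primes, `e, X, Z ≥ 1`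
and at most one of `i, j, m` positive:

* `decisivePrimeBootstrap_shape` (registered sub-goal of the stub) — the odd primes `ℓ ∣ a`,
  `P ∣ b`, `Q ∣ c` and `(abc).primeFactors = {2, ℓ, P, Q}`;
* `decisivePrimeBootstrap_member_eq` — each member is `2^{v₂} · p^{v_p}`;
* `decisivePrimeBootstrap_prod_factorization_eq` —
  `∏_{p ∣ abc} v_p(abc) = (i + j + m) · e · X · Z`;
* `decisivePrimeBootstrap_key_identity` — `±a = p^x + σ 2^{k'} q^y` in the two big members, so
  `v_ℓ(a)` is the `ℓ`-adic depth `padicValInt ℓ (p^x + σ 2^{k'} q^y)` of the two-logarithm form.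

The real-variable part is in `…StubDecisivePrimeBootstrapLemmas`, the stub itself in
`…StubDecisivePrimeBootstrap`.
-/

-- `Summit.ABC.ABC` is the mandated summit-side namespace (CONVENTIONS §2); the duplicate is
-- deliberate.
set_option linter.dupNamespace false

namespace Summit.ABC.ABC.Theorems.FewPrimeValuationProduct

open Finset
open Literature.NumberTheory.DiophantineGeometry
open Literature.NumberTheory.DiophantineGeometry.Pasten

/-! ## Arithmetic of non-face triples on four primes -/

/-- A positive integer that is not a power of two has an odd prime factor. `[folklore]` -/
theorem decisivePrimeBootstrap_exists_odd_prime_dvd {n : ℕ} (hn : ¬ ∃ j : ℕ, n = 2 ^ j) :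
    ∃ p : ℕ, p.Prime ∧ p ∣ n ∧ p ≠ 2 := by
  obtain ⟨p, hp, hpn, hodd⟩ := (Nat.eq_two_pow_or_exists_odd_prime_and_dvd n).resolve_left hn
  refine ⟨p, hp, hpn, ?_⟩
  rintro rfl
  exact (Nat.not_even_iff_odd.mpr hodd) even_two

/-- A prime dividing one of two coprime numbers does not divide the other. `[folklore]` -/
theorem decisivePrimeBootstrap_not_dvd_of_coprime {p m n : ℕ} (hp : p.Prime) (hmn : m.Coprime n)
    (hpm : p ∣ m) : ¬ p ∣ n :=
  fun hpn => hp.one_lt.ne' ((Nat.Coprime.coprime_dvd_left hpm hmn).eq_one_of_dvd hpn)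

/-- **Shape of a non-face triple on `≤ 4` primes.** Each member carries an odd prime (`ℓ ∣ a`,
`P ∣ b`, `Q ∣ c`, pairwise distinct by coprimality), one member is even, and therefore the prime
factors of `abc` are exactly `{2, ℓ, P, Q}`. `[folklore]` -/
theorem decisivePrimeBootstrap_shape :
    ∀ {a b c : ℕ}, Literature.NumberTheory.DiophantineGeometry.IsABCTriple a b c →
    (a * b * c).primeFactors.card ≤ 4 →
    ¬ ((∃ j : ℕ, a = 2 ^ j) ∨ (∃ j : ℕ, b = 2 ^ j) ∨ (∃ j : ℕ, c = 2 ^ j)) →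
    ∃ ℓ P Q : ℕ, ℓ.Prime ∧ P.Prime ∧ Q.Prime ∧ ℓ ≠ 2 ∧ P ≠ 2 ∧ Q ≠ 2 ∧ ℓ ≠ P ∧ ℓ ≠ Q ∧ P ≠ Q ∧
      ℓ ∣ a ∧ P ∣ b ∧ Q ∣ c ∧ (a * b * c).primeFactors = {2, ℓ, P, Q} := by
  intro a b c h hcard hface
  obtain ⟨ha, hb, hsum, hcop⟩ := id h
  simp only [not_or] at hface
  obtain ⟨hfa, hfb, hfc⟩ := hface
  obtain ⟨ℓ, hℓ, hℓa, hℓ2⟩ := decisivePrimeBootstrap_exists_odd_prime_dvd hfa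
  obtain ⟨P, hP, hPb, hP2⟩ := decisivePrimeBootstrap_exists_odd_prime_dvd hfb
  obtain ⟨Q, hQ, hQc, hQ2⟩ := decisivePrimeBootstrap_exists_odd_prime_dvd hfc
  have hac : a.Coprime c := coprime_left_of_isABCTriple h
  have hbc : b.Coprime c := coprime_right_of_isABCTriple h
  have hℓP : ℓ ≠ P := fun heq => decisivePrimeBootstrap_not_dvd_of_coprime hℓ hcop hℓa (heq ▸ hPb)
  have hℓQ : ℓ ≠ Q := fun heq => decisivePrimeBootstrap_not_dvd_of_coprime hℓ hac hℓa (heq ▸ hQc)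
  have hPQ : P ≠ Q := fun heq => decisivePrimeBootstrap_not_dvd_of_coprime hP hbc hPb (heq ▸ hQc)
  have hc : 0 < c := by omega
  have h0 : a * b * c ≠ 0 := by positivity
  have h2 : 2 ∣ a * b * c := by
    by_contra hnot
    have h2a : ¬ 2 ∣ a := fun h2a => hnot (dvd_mul_of_dvd_left (dvd_mul_of_dvd_left h2a b) c)
    have h2b : ¬ 2 ∣ b := fun h2b => hnot (dvd_mul_of_dvd_left (dvd_mul_of_dvd_right h2b a) c)
    have h2c : 2 ∣ c := by omega
    exact hnot (dvd_mul_of_dvd_right h2c _)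
  have hsub : ({2, ℓ, P, Q} : Finset ℕ) ⊆ (a * b * c).primeFactors := by
    intro p hp
    simp only [Finset.mem_insert, Finset.mem_singleton] at hp
    rw [Nat.mem_primeFactors]
    rcases hp with rfl | rfl | rfl | rfl
    · exact ⟨Nat.prime_two, h2, h0⟩
    · exact ⟨hℓ, (hℓa.mul_right b).mul_right c, h0⟩
    · exact ⟨hP, (hPb.mul_left a).mul_right c, h0⟩
    · exact ⟨hQ, hQc.mul_left (a * b), h0⟩
  have hcard4 : ({2, ℓ, P, Q} : Finset ℕ).card = 4 := by
    rw [Finset.card_insert_of_notMem, Finset.card_insert_of_notMem, Finset.card_pair hPQ]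
    all_goals simp only [Finset.mem_insert, Finset.mem_singleton]; omega
  have heq : ({2, ℓ, P, Q} : Finset ℕ) = (a * b * c).primeFactors :=
    Finset.eq_of_subset_of_card_le hsub (by omega)
  exact ⟨ℓ, P, Q, hℓ, hP, hQ, hℓ2, hP2, hQ2, hℓP, hℓQ, hPQ, hℓa, hPb, hQc, heq.symm⟩

/-- A member `n` of `m = abc` whose prime factors lie in `{2, p}` is `2^{v₂(n)} · p^{v_p(n)}`.
`[folklore]` -/
theorem decisivePrimeBootstrap_member_eq {n m p u v : ℕ} (hn : n ≠ 0) (hm : m ≠ 0) (hnm : n ∣ m)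
    (h2p : 2 ≠ p) (hpf : ∀ q ∈ m.primeFactors, q = 2 ∨ q = p ∨ q = u ∨ q = v) (hu : ¬ u ∣ n)
    (hv : ¬ v ∣ n) :
    n = 2 ^ n.factorization 2 * p ^ n.factorization p := by
  have hsub : n.primeFactors ⊆ {2, p} := by
    intro q hq
    have hq' := Nat.primeFactors_mono hnm hm hq
    have hqn := Nat.dvd_of_mem_primeFactors hq
    rcases hpf q hq' with rfl | rfl | rfl | rfl
    · simp
    · simp
    · exact absurd hqn hu
    · exact absurd hqn hv
  have hsub' : n.factorization.support ⊆ {2, p} := by rwa [Nat.support_factorization]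
  have key : n = ∏ q ∈ ({2, p} : Finset ℕ), q ^ n.factorization q := by
    rw [← Finsupp.prod_of_support_subset n.factorization hsub' (fun q k => q ^ k)
      (fun _ _ => pow_zero _)]
    exact (Nat.prod_factorization_pow_eq_self hn).symm
  rwa [Finset.prod_pair h2p] at key

/-- The valuation product of `abc` with prime factors `{2, ℓ, P, Q}` (`ℓ ∣ a`, `P ∣ b`, `Q ∣ c`
only): `∏_{p ∣ abc} v_p(abc) = (v₂(a) + v₂(b) + v₂(c)) · v_ℓ(a) · v_P(b) · v_Q(c)`. `[folklore]` -/
theorem decisivePrimeBootstrap_prod_factorization_eq {a b c ℓ P Q : ℕ} (ha : a ≠ 0) (hb : b ≠ 0)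
    (hc : c ≠ 0)
    (heq : (a * b * c).primeFactors = {2, ℓ, P, Q}) (h2ℓ : 2 ≠ ℓ) (h2P : 2 ≠ P) (h2Q : 2 ≠ Q)
    (hℓP : ℓ ≠ P) (hℓQ : ℓ ≠ Q) (hPQ : P ≠ Q) (hℓb : ¬ ℓ ∣ b) (hℓc : ¬ ℓ ∣ c) (hPa : ¬ P ∣ a)
    (hPc : ¬ P ∣ c) (hQa : ¬ Q ∣ a) (hQb : ¬ Q ∣ b) :
    ∏ p ∈ (a * b * c).primeFactors, (a * b * c).factorization p =
      (a.factorization 2 + b.factorization 2 + c.factorization 2) * a.factorization ℓ *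
        b.factorization P * c.factorization Q := by
  have hf : ∀ p, (a * b * c).factorization p =
      a.factorization p + b.factorization p + c.factorization p := by
    intro p
    rw [Nat.factorization_mul (mul_ne_zero ha hb) hc, Nat.factorization_mul ha hb]
    rfl
  rw [heq, Finset.prod_insert, Finset.prod_insert, Finset.prod_pair hPQ]
  · rw [hf 2, hf ℓ, hf P, hf Q, Nat.factorization_eq_zero_of_not_dvd hℓb,
      Nat.factorization_eq_zero_of_not_dvd hℓc, Nat.factorization_eq_zero_of_not_dvd hPa,
      Nat.factorization_eq_zero_of_not_dvd hPc, Nat.factorization_eq_zero_of_not_dvd hQa,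
      Nat.factorization_eq_zero_of_not_dvd hQb]
    ring
  all_goals simp only [Finset.mem_insert, Finset.mem_singleton]; omega

/-- **The key identity.** For `a + b = c` with `b = 2^j P^X`, `c = 2^m Q^Z` and `j = 0` or `m = 0`,
the member `a` is, up to sign, a two-term expression `p^x + σ 2^{k'} q^y` in the two big members,
so its `ℓ`-adic valuation is the `ℓ`-adic depth of that expression. `[folklore]` -/
theorem decisivePrimeBootstrap_key_identity {a b c P Q j m X Z : ℕ} (hsum : a + b = c)
    (hrepb : b = 2 ^ j * P ^ X) (hrepc : c = 2 ^ m * Q ^ Z) (hjm : j = 0 ∨ m = 0) (ℓ : ℕ) :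
    (∃ σ : ℤ, (σ = 1 ∨ σ = -1) ∧
      padicValInt ℓ ((Q : ℤ) ^ Z + σ * 2 ^ j * (P : ℤ) ^ X) = padicValNat ℓ a) ∨
    (∃ σ : ℤ, (σ = 1 ∨ σ = -1) ∧
      padicValInt ℓ ((P : ℤ) ^ X + σ * 2 ^ m * (Q : ℤ) ^ Z) = padicValNat ℓ a) := by
  have hsum' : (a : ℤ) + b = c := by exact_mod_cast hsum
  rcases hjm with hj | hm
  · right
    refine ⟨-1, Or.inr rfl, ?_⟩
    have hb' : (b : ℤ) = (P : ℤ) ^ X := by rw [hrepb, hj]; push_cast; ring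
    have hc' : (c : ℤ) = 2 ^ m * (Q : ℤ) ^ Z := by rw [hrepc]; push_cast; ring
    have hexpr : (P : ℤ) ^ X + (-1) * 2 ^ m * (Q : ℤ) ^ Z = -(a : ℤ) := by
      rw [← hb', mul_assoc, ← hc']; linarith
    rw [hexpr, padicValInt, Int.natAbs_neg, Int.natAbs_natCast]
  · left
    refine ⟨-1, Or.inr rfl, ?_⟩
    have hb' : (b : ℤ) = 2 ^ j * (P : ℤ) ^ X := by rw [hrepb]; push_cast; ring
    have hc' : (c : ℤ) = (Q : ℤ) ^ Z := by rw [hrepc, hm]; push_cast; ring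
    have hexpr : (Q : ℤ) ^ Z + (-1) * 2 ^ j * (P : ℤ) ^ X = (a : ℤ) := by
      rw [← hc', mul_assoc, ← hb']; linarith
    rw [hexpr, padicValInt, Int.natAbs_natCast]

end Summit.ABC.ABC.Theorems.FewPrimeValuationProduct
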